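/-
Copyright (c) 2026 the pub-hodgecm-mathlib formalisation cell (harness21).  Prover seat hodgecm-mathlib-LH4-p14 (g5), req620 Track A «(D-RAM) FOUR-FRAME» squad, unit U2H:
the (ρ2b′-X) child `stub_U2H_fixedPointCensus_typeTwo_unit0` (U2H ED. 15 :418) — bottom (A) (type U) of the payer's MAP v3: LH4-p11 (g5)'s brick 9a «hKnorm» (unit-norm
surjectivity of the unramified third field `Fix(Θρ) ∕ F`, 2026-09-04T07:12Z), hand «9a: mine» 07:14Z.  2026-09-04.
-/
import Summits.HodgeConjecture.HodgeConjecture.Theorems.F0P3cDyRamThirdFieldPackageUnr           -- ★ S2′ (LH4-p05 (g4)): `exists_unit_mul_map_eq` (Serre V §2: `U_{K♮} = N(U)` for an unramified involution)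
import Summits.HodgeConjecture.HodgeConjecture.Theorems.F0P3cDyRamTokenRealizabilityUnrOfFrame   -- ★ p858115 (this seat): `thetaRhoFixed_generator` (`α′ := α·ρ(Θα)`)
import Summits.HodgeConjecture.HodgeConjecture.Theorems.F0P3cDyRamThetaRhoFixedEven              -- ★ p858152 (this seat): `sub_lt_one_of_coords` (`Θρ` residually trivial); brings ★ p857938
import HarnessLib

/-!
# Crux `H413`, line LH4 «(D-RAM) FOUR-FRAME» — unit U2H, (ρ2b′-X) bottom (A): EVERY UNIT OF `F` IS A NORM FROM THE UNRAMIFIED THIRD FIELD `K₃ = Fix(Θρ)`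
# (Serre, *Local Fields* V §2 Prop. 3 for `K₃ ∕ F`, assembled inside `M` from ★ organs)

Cell `hodgecm-mathlib` (D-0151), FLOOR 0, crux item H413 = `stmt-HodgeConjecture-24833`, route of record `HCCMUnconditional`; squad F0∕P3c∕LH4; registered stub served:
`F0P3cDyRamFourFrameU2H.stub_U2H_fixedPointCensus_typeTwo_unit0` ((ρ2b′-X), U2H ED. 15 :418), through the payer's pay line … ∘ ★ `TypeSplit.orderCountCensus2_of_types (hA) …`,
typed bottom (A) = `SOCKET-hOCA.v1` (LH4-p11 (g5)): the O-Sign organ ★ p857454 `hilbertSymbol_token_eq_neg_one_pow` wants the unramified class of `a = Tr λ′ − 2` through ★ p857525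
`hilbertSymbol_eq_one_iff_even_of_unramifiedModel (… hKev hKnorm …)`; `hKev` is ★ p858152 `even_v_of_thetaRho_fixed`, and THIS file is `hKnorm`.  THEOREMS ONLY (no `def`, no instance,
no notation, no `sorry`); lane `--supports stmt-HodgeConjecture-24833` (count-neutral).

WHAT IS PROVED.  `M` (the Lean `K : Type`) complete with a `ℤᵐ⁰`-valuation and finite residue field, `ρ, Θ` commuting involutive isometries, `|2| < 1`; the printed type-(A)
letters (`|α| ≤ 1`, integrality of the `ρ`-coordinates, `|α − ρα| = 1`, `|ρα − Θα| < 1`), the CM-place fact `hσres : ρ z = z → |z| ≤ 1 → |Θz − z| < 1`, a `ρ`-fixed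
uniformiser `ϖE` with `ΘϖE ≠ ϖE`.  THEN **every `z₀` with `ρ z₀ = z₀`, `Θ z₀ = z₀`, `|z₀| = 1` (a unit of `F`) is `κ·ρκ` for a `Θρ`-fixed unit `κ`** (`exists_thetaRho_fixed_unit_norm_eq`)
— `ρ|_{K₃}` is the non-trivial automorphism of `K₃ = Fix(Θρ)` over `F`, so this is `U_F = N_{K₃∕F}(U_{K₃})`.
PROOF = three ★ organs: (1) ★ p857938 `ValuedFixedFieldRamified.exists_valuedFixedField_ramified_of_ne` (LH4-p12 (g5)) at the pair `(τ := Θ∘ρ, ρ)` — `τ` is a residually trivial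
isometric involution (★ `sub_lt_one_of_coords`) moving `ϖE` and commuting with `ρ` — realises `K₃` as a complete valued field `K'` with `jK : K' → M` onto `Fix τ`, `jK ∘ σ' = ρ ∘ jK`,
`|jK x| = |x|²`; (2) the exact generator `α′ = α·ρ(Θα) ∈ Fix τ` (★ `thetaRhoFixed_generator`) pulls back to an integral `a'` with `|σ'a' − a'| = 1` (`K' ∕ Fix σ'` UNRAMIFIED);
(3) ★ S2′ `F0P3cDyRamThirdFieldPackageUnr.exists_unit_mul_map_eq` in `K'` (Serre V §2 Prop. 3 via `𝓂`-adic completeness) writes `jK⁻¹ z₀ = ω·σ'ω`, and `κ := jK ω`.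
HONEST LABEL.  Count-neutral helper; (ρ2b′-X) OPEN; `HC_CM` is proved only modulo the 7 printed citations (2 remaining named inputs: hLiu418 = `stmt-HodgeConjecture-24832`, h413 =
`stmt-HodgeConjecture-24833`) until rung 0 closes.

## References
* [Serre1979] J.-P. Serre, *Local Fields*, GTM 67 (1979), Ch. V §2 Prop. 3 and Cor.; Ch. I §4 Prop. 10, §7 Prop. 20–21.
* [NeukirchANT1999] J. Neukirch, *Algebraic Number Theory*, Grundlehren 322 (1999), Ch. II (4.8)–(4.9).
* [Rogawski1990] J. D. Rogawski, *Automorphic Representations of Unitary Groups in Three Variables*, Ann. of Math. Stud. 123 (1990), §4.9 Lemma 4.9.3 p. 56.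
-/

set_option autoImplicit false

noncomputable section

open WithZero
open scoped Valued

namespace Summit.HodgeConjecture.HodgeConjecture.Cruxes.H413.F0P3cDyRamThetaRhoFixedNormUnit

/-- In `ℤᵐ⁰`: `x² = 1 ⇒ x = 1`. [cite: Serre1979, Ch. I §4] -/
theorem eq_one_of_sq_eq_one {x : ℤᵐ⁰} (h : x ^ 2 = 1) : x = 1 :=
  (pow_left_inj₀ zero_le zero_le two_ne_zero).1 (by rw [h, one_pow])

/-- **`U_F = N_{K₃∕F}(U_{K₃})` INSIDE `M`** — see the module docstring: every `ρ`- and `Θ`-fixed `z₀` with `|z₀| = 1` is `κ·ρκ` with `Θ(ρκ) = κ`, `|κ| = 1`.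
[cite: Serre1979, Ch. V §2 Prop. 3 and Cor.; Ch. I §4 Prop. 10] [cite: NeukirchANT1999, Ch. II (4.8)–(4.9)] [cite: Rogawski1990, §4.9 Lemma 4.9.3 p. 56] -/
theorem exists_thetaRho_fixed_unit_norm_eq {K : Type} [Field K] [Valued K ℤᵐ⁰] [CompleteSpace K] [Finite (Valued.ResidueField K)]
    {ρ Θ : K →+* K} (hρρ : ∀ x, ρ (ρ x) = x) (hvρ : ∀ x, Valued.v (ρ x) = Valued.v x) (hΘΘ : ∀ x, Θ (Θ x) = x)
    (hΘρ : ∀ x, Θ (ρ x) = ρ (Θ x)) (hvΘ : ∀ x, Valued.v (Θ x) = Valued.v x) (h2 : Valued.v (2 : K) < 1)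
    {α : K} (hα1 : Valued.v α ≤ 1) (hint : ∀ z : K, Valued.v z ≤ 1 → Valued.v ((z - ρ z) / (α - ρ α)) ≤ 1)
    (hα : Valued.v (α - ρ α) = 1) (hτα : Valued.v (ρ α - Θ α) < 1)
    (hσres : ∀ z : K, ρ z = z → Valued.v z ≤ 1 → Valued.v (Θ z - z) < 1)
    {ϖE : K} (hϖE : Valued.v ϖE = exp (-1 : ℤ)) (hρϖE : ρ ϖE = ϖE) (hΘϖE : Θ ϖE ≠ ϖE)
    (z₀ : K) (hρz : ρ z₀ = z₀) (hΘz : Θ z₀ = z₀) (hz1 : Valued.v z₀ = 1) :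
    ∃ κ : K, Θ (ρ κ) = κ ∧ Valued.v κ = 1 ∧ κ * ρ κ = z₀ := by
  -- `τ := Θ ∘ ρ`: a residually trivial isometric involution moving `ϖE` and commuting with `ρ`
  set τ : K →+* K := Θ.comp ρ with hτdef
  have hτ : ∀ z, τ z = Θ (ρ z) := fun z => rfl
  have hττ : ∀ z, τ (τ z) = z := fun z => by rw [hτ, hτ, hΘρ, hΘΘ, hρρ]
  have hvτ : ∀ z, Valued.v (τ z) = Valued.v z := fun z => by rw [hτ, hvΘ, hvρ]
  have hτres : ∀ z : K, Valued.v z ≤ 1 → Valued.v (z - τ z) < 1 := fun z hz => by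
    rw [Valuation.map_sub_swap, hτ]; exact F0P3cDyRamThetaRhoFixedEven.sub_lt_one_of_coords hρρ hΘΘ hvρ hvΘ hα1 hα hint hτα hσres hz
  have hτne : ∃ z, τ z ≠ z := ⟨ϖE, by rw [hτ, hρϖE]; exact hΘϖE⟩
  have hτρ : ∀ z, τ (ρ z) = ρ (τ z) := fun z => by rw [hτ, hτ, hρρ, ← hΘρ, hρρ]
  -- (1) the third field `K₃ = Fix τ` as a valued field `K'`
  obtain ⟨K', _iF, _iV, σ', π', jK, _hDVR, hfin, _hcard, hcomp, hσ'σ', hvσ', hjv2, hjle, hτj, hjsurj, hjσ', hπ', _hjπ', _hres⟩ :=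
    Literature.NumberTheory.LocalFields.ValuedFixedFieldRamified.exists_valuedFixedField_ramified_of_ne hττ hvτ hτres hτne hρρ hvρ hτρ hϖE
  haveI : CompleteSpace K' := hcomp
  haveI : Finite 𝓀[K'] := hfin
  have hj1 : jK 1 = 1 := map_one jK
  -- (2) the unramified generator of `K' ∕ Fix σ'`: the pull-back of `α′ = α·ρ(Θα)`
  obtain ⟨hΘα', hα'1, hα'ρ⟩ := F0P3cDyRamTokenRealizabilityUnrOfFrame.thetaRhoFixed_generator hρρ hΘΘ hΘρ hvρ hvΘ h2 hα1 hα hτα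
  have hτα' : τ (α * ρ (Θ α)) = α * ρ (Θ α) := by
    have h := congrArg Θ hΘα'
    rw [hΘΘ] at h
    rw [hτ]; exact h.symm
  obtain ⟨a', ha'⟩ := hjsurj _ hτα'
  have ha'1 : Valued.v a' ≤ 1 := by
    have h := (hjle a' 1).1 (by rw [hj1, Valuation.map_one, ha']; exact hα'1)
    rwa [Valuation.map_one] at h
  have hσ'a' : Valued.v (σ' a' - a') = 1 := by
    apply eq_one_of_sq_eq_one
    rw [← hjv2, map_sub, hjσ', ha', ← Valuation.map_neg, neg_sub]; exact hα'ρ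
  -- the pull-back of `z₀`
  have hτz : τ z₀ = z₀ := by rw [hτ, hρz, hΘz]
  obtain ⟨z', hz'⟩ := hjsurj z₀ hτz
  have hσ'z' : σ' z' = z' := jK.injective (by rw [hjσ', hz', hρz])
  have hz'1 : Valued.v z' = 1 := by
    apply eq_one_of_sq_eq_one
    rw [← hjv2, hz']; exact hz1
  have hz'0 : z' ≠ 0 := fun h => by rw [h, Valuation.map_zero] at hz'1; exact zero_ne_one hz'1
  -- (3) Serre V §2 Prop. 3 in `K'`
  obtain ⟨ω, hω1, hω⟩ := F0P3cDyRamThirdFieldPackageUnr.exists_unit_mul_map_eq hσ'σ' hvσ' ha'1 hσ'a' hπ' (Units.mk0 z' hz'0) hσ'z' hz'1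
  refine ⟨jK ω, hτj _, ?_, ?_⟩
  · apply eq_one_of_sq_eq_one  -- `|jK ω| = |ω|² = 1`
    rw [hjv2, hω1, one_pow, one_pow]
  · rw [← hjσ', ← map_mul, hω, Units.val_mk0, hz']

end Summit.HodgeConjecture.HodgeConjecture.Cruxes.H413.F0P3cDyRamThetaRhoFixedNormUnit

end
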